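import Literature.NumberTheory.GaloisRepresentations.IdeleClassBarKS
import Literature.NumberTheory.GaloisRepresentations.IdeleUnitsOffSBaseChange
import HarnessLib

/-!
# The `S`-idèle class module `C̄_S = C_{K_S} ⧸ Ū_S` of `G_S = Gal(K_S/K)`, `Ū_S = ⋃_{E ⊆ K_S} U_{E,S}`, as a discrete
# `G_S`-module (Harari Def. 15.38 / Thm. 17.2; Milne ADT I §4; NSW (8.3.8)–(8.3.9))

Topic `NumberTheory/GaloisRepresentations`; namespace `Literature.NumberTheory.GaloisRepresentations.IdeleClassBar`.
Sequel to `IdeleClassBarKS.lean` (`classBarKS K S = C_{K_S} = C̄^{N_S} = ⋃_{E ⊆ K_S} C_E` as a `Rep ℤ G_S`, `toKS hE :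
C_E →+ C_{K_S}`, `exists_toKS`, discreteness), to `IdeleClassModUnitsS.lean` (`unitsOffToClass S : U_{E,S} → C_E`,
injective, `classModUnitsRep K E S = C_S(E) = C_E ⧸ U_{E,S}`) and to bsd-line-x1-p1-w5's `IdeleUnitsOffSBaseChange.lean`
(D1-(i): base change maps `im U_{E,S}` into `im U_{E',S}`; Galois stability).  Definitions with bodies and theorems; NO
named fact, no `sorry`, no instance, no notation; number fields in `Type`.  Cell `bsd-eis`, background lane «PT-Ш-S-TC»,
brick D1-(ii) part 2 — the objects `Ū_S`, `C̄_S`; written `--supports` crux `GoodLatticeBDPValue`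
(stmt-BirchSwinnertonDyer-19032).  HONEST FRAMING: definitions and bookkeeping of classical objects; no duality theorem,
no case of BSD is proved here.

Mathematics (Harari, *Galois Cohomology and Class Field Theory* (2020), Def. 15.38 "`C_S(F) := I_F / F^* U_{F,S}`", proof
of Thm. 17.2 (p. 289) "the `G_S`-modules `U_S`, `C_S`"; Milne, *Arithmetic Duality Theorems* I §4 (p. 55); NSW (8.3.8)
`C_S := lim→ C_S(K')`, (8.3.9) `U_S := lim→ U_{K,S}`).  With `C_{K_S} = ⋃_{E ⊆ K_S} C_E` (`IdeleClassBarKS.lean`):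
* **`Ū_S := ⋃_{E ⊆ K_S} im(U_{E,S} → C_E → C_{K_S})`** (`unitsOffKS`), a submodule — the union is DIRECTED by D1-(i)
  (`exists_unitsToKS_eq_of_le`), hence closed under addition — and `G_S`-stable (`U_{E,S} → C_E` is
  `Gal(E/K)`-equivariant, `classBarKS_ρ_mk_unitsToKS`).
* **`C̄_S := C_{K_S} ⧸ Ū_S`** with the induced `G_S`-action (Mathlib `Representation.quotient`): by exactness of filtered
  colimits this is `lim→_{E ⊆ K_S} C_E ⧸ U_{E,S} = lim→ C_S(E)`, Harari's / Milne's / NSW's `C_S`.  Every element comes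
  from a layer (`exists_ofLayerS`), `U_{E,S}` dies (`ofLayerS_unitsOffToClass`), `Gal(K_S/E)` fixes the image of `C_E`
  (`classBarSRep_ρ_mk_ofLayerS_of_mem`), and `C̄_S` is a quotient of the discrete `C_{K_S}`, hence discrete:
  `C̄_S ∈ C_{G_S} = DiscreteRepCat ℤ G_S` (`classBarSD`) — the module of the `P`-class formation `(G_S, C̄_S)` on which
  door-c4's (`p`-primary) Tate duality engine is to be run.

Not here (sequel files of the lane): the kernel of `C_E → C̄_S` is EXACTLY `U_{E,S}` and `C̄_S^{Gal(K_S/E)} = C_S(E)`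
(the latter needs `H¹(Gal(M/E), U_{M,S}) = 0` for `E ⊆ M ⊆ K_S`), the invariant map `inv_S`, the duality hypotheses.

## What is formalised (`K : Type` a number field, `S : Finset (HeightOneSpectrum (𝓞 K))`, `G_S = GaloisGroupUnramifiedOutside K ↑S`)

* §3 `unitsToKS hE : U_{E,S} →+ C_{K_S}` (+ `unitsToKS_apply`), **`exists_unitsToKS_eq_of_le`** (directedness),
  **`unitsOffKS K S : Submodule ℤ (classBarKS K S).V`** (`= Ū_S`, for the module structure carried by the representation),
  `mem_unitsOffKS_iff`, `unitsToKS_mem`, `toKS_mem_unitsOffKS_of_mem_range`, `classBarKS_ρ_mk_unitsToKS`,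
  **`unitsOffKS_le_comap`** (stability).
* §4 **`classBarSRepr` / `classBarSRep K S : Rep ℤ G_S`** (`= C̄_S`), `classBarSRep_ρ_mk`, **`toClassBarS : C_{K_S} ⟶ C̄_S`**
  (+ `toClassBarS_hom_apply`, `toClassBarS_surjective`), **`ofLayerS hE : C_E →+ C̄_S`** (+ `ofLayerS_apply`,
  `ofLayerS_transHom`, **`exists_ofLayerS`**, `ofLayerS_eq_zero_iff_mem`, **`ofLayerS_unitsOffToClass`**,
  `ofLayerS_eq_zero_of_mem_range`, `classBarSRep_ρ_mk_ofLayerS`, **`classBarSRep_ρ_mk_ofLayerS_of_mem`**),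
  `map_galFixing_le_stabilizer_ofLayerS`, **`isDiscrete_classBarSRep`**, **`classBarSD K S : DiscreteRepCat ℤ G_S`**,
  `toClassBarSD` (+ `toClassBarSD_hom`).

## References
* D. Harari, *Galois Cohomology and Class Field Theory*, Universitext (2020), Def. 15.38, §17.1 Thm. 17.2 (proof, p. 289).
  [Harari2020]
* J. S. Milne, *Arithmetic Duality Theorems*, 2nd ed. (2006), I §4 (p. 55, `C_S = lim→ C_F`; `(G_S, C_S)` a `P`-class
  formation). [MilneADT2006]
* J. Neukirch, A. Schmidt, K. Wingberg, *Cohomology of Number Fields*, 2nd ed. (2008), VIII §3 (8.3.8)–(8.3.9).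
  [NeukirchSchmidtWingberg2008]
-/

noncomputable section

open NumberField IsDedekindDomain CategoryTheory
open Field (absoluteGaloisGroup)
open Literature.NumberTheory.Automorphic Literature.NumberTheory.Automorphic.IdeleClassGroup
open Literature.NumberTheory.NumberFields
open Literature.Algebra.Homology
open Literature.NumberTheory.GaloisRepresentations.LocalWeilDatum (galFixing mem_galFixing_iff isOpen_galFixing
  galFixing_antitone galFixing_sup)
open scoped Classical

namespace Literature.NumberTheory.GaloisRepresentations

namespace IdeleClassBar

variable {K : Type} [Field K] [NumberField K] (S : Finset (HeightOneSpectrum (𝓞 K)))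

/-! ## §3. `Ū_S = ⋃_{E ⊆ K_S} U_{E,S}` inside `C_{K_S}` -/

/-- The image of `U_{E,S} → C_E → C_{K_S}` for a layer `E ⊆ K_S`: the elements `[u]_E`, `u ∈ U_{E,S}` (an additive map;
`unitsOffToClass S : U_{E,S} → C_E` is `IdeleClassModUnitsS.lean`'s). [cite: Harari2020, Def. 15.38] -/
def unitsToKS {E : GalLayer K} (hE : ramificationSubgroup K (↑S : Set (HeightOneSpectrum (𝓞 K))) ≤ galFixing K E.1) :
    (haveI := E.numberField; (IdeleCohomology.unitsOffRep K E.1 S).V) →+ (classBarKS K S).V :=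
  haveI := E.numberField
  (toKS S hE).comp (IdeleCohomology.unitsOffToClass (F := K) (E := E.1) S).hom.toLinearMap.toAddMonoidHom

/-- Formula: `unitsToKS hE u = [unitsOffToClass u]_E`. [cite: Harari2020, Def. 15.38] -/
theorem unitsToKS_apply {E : GalLayer K}
    (hE : ramificationSubgroup K (↑S : Set (HeightOneSpectrum (𝓞 K))) ≤ galFixing K E.1)
    (u : haveI := E.numberField; (IdeleCohomology.unitsOffRep K E.1 S).V) :
    unitsToKS S hE u = toKS S hE (haveI := E.numberField; (IdeleCohomology.unitsOffToClass (F := K) (E := E.1) S).hom u) :=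
  rfl

/-- **Base change inside `K_S` maps `[U_{E,S}]_E` into `[U_{E',S}]_{E'}`** (D1-(i) `classBaseChange_mem_range_unitsOffToClass`
read in `C_{K_S}`): for `E ≤ E'` inside `K_S` and `u ∈ U_{E,S}` there is `u' ∈ U_{E',S}` with `[u']_{E'} = [u]_E` in `C_{K_S}`.
[cite: Harari2020, Def. 15.38, proof of Thm. 17.2][cite: NeukirchSchmidtWingberg2008, VIII §3 (8.3.9)] -/
theorem exists_unitsToKS_eq_of_le {E E' : GalLayer K} (h : E ≤ E')
    (hE : ramificationSubgroup K (↑S : Set (HeightOneSpectrum (𝓞 K))) ≤ galFixing K E.1)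
    (hE' : ramificationSubgroup K (↑S : Set (HeightOneSpectrum (𝓞 K))) ≤ galFixing K E'.1)
    (u : haveI := E.numberField; (IdeleCohomology.unitsOffRep K E.1 S).V) :
    ∃ u' : (haveI := E'.numberField; (IdeleCohomology.unitsOffRep K E'.1 S).V), unitsToKS S hE' u' = unitsToKS S hE u := by
  haveI := E.numberField
  haveI := E'.numberField
  by_cases heq : E = E'
  · subst heq
    exact ⟨u, rfl⟩
  letI := GalLayer.algebraOfLE h
  haveI := GalLayer.isScalarTower_of_le h
  obtain ⟨u', hu'⟩ := IdeleCohomology.classBaseChange_mem_range_unitsOffToClass (E' := E'.1) S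
    (c := (IdeleCohomology.unitsOffToClass (F := K) (E := E.1) S).hom u) ⟨u, rfl⟩
  refine ⟨u', ?_⟩
  rw [unitsToKS_apply, unitsToKS_apply, ← toKS_transHom S h hE hE', transHom_of_ne h heq]
  exact congrArg (toKS S hE') hu'

variable (K) in
/-- **`Ū_S := ⋃_{E ⊆ K_S} im(U_{E,S} → C_E → C_{K_S})`** as a submodule of `C_{K_S}` (NSW (8.3.9) `U_S = lim→ U_{F,S}`; a
DIRECTED union by D1-(i), whence closed under addition; `ℤ`-multiples stay in each layer image).
[cite: NeukirchSchmidtWingberg2008, VIII §3 (8.3.9)][cite: Harari2020, Def. 15.38, §17.1 Thm. 17.2 (proof)] -/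
def unitsOffKS : letI := (classBarKS K S).hV2; Submodule ℤ (classBarKS K S).V :=
  letI := (classBarKS K S).hV2
  { carrier := {z | ∃ (E : GalLayer K) (hE : ramificationSubgroup K (↑S : Set (HeightOneSpectrum (𝓞 K))) ≤ galFixing K E.1)
      (u : haveI := E.numberField; (IdeleCohomology.unitsOffRep K E.1 S).V), unitsToKS S hE u = z}
    zero_mem' := ⟨GalLayer.bot K, insideKS_bot S, 0, map_zero _⟩
    add_mem' := by
      rintro _ _ ⟨E₁, hE₁, u₁, rfl⟩ ⟨E₂, hE₂, u₂, rfl⟩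
      obtain ⟨M, h₁, h₂, hM⟩ := exists_ge_ge_insideKS S hE₁ hE₂
      obtain ⟨v₁, hv₁⟩ := exists_unitsToKS_eq_of_le S h₁ hE₁ hM u₁
      obtain ⟨v₂, hv₂⟩ := exists_unitsToKS_eq_of_le S h₂ hE₂ hM u₂
      exact ⟨M, hM, v₁ + v₂, by rw [map_add, hv₁, hv₂]⟩
    smul_mem' := by
      rintro c _ ⟨E, hE, u, rfl⟩
      -- every `ℤ`-module structure is the `zsmul` one, and additive maps commute with `zsmul`
      exact ⟨E, hE, c • u, map_zsmul (unitsToKS S hE) c u⟩ }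

/-- Membership in `Ū_S`: `z = [u]_E` for some layer `E ⊆ K_S` and some `u ∈ U_{E,S}` (definitional).
[cite: NeukirchSchmidtWingberg2008, VIII §3 (8.3.9)] -/
theorem mem_unitsOffKS_iff (z : (classBarKS K S).V) :
    z ∈ unitsOffKS K S ↔
      ∃ (E : GalLayer K) (hE : ramificationSubgroup K (↑S : Set (HeightOneSpectrum (𝓞 K))) ≤ galFixing K E.1)
        (u : haveI := E.numberField; (IdeleCohomology.unitsOffRep K E.1 S).V), unitsToKS S hE u = z :=
  Iff.rfl

/-- `[u]_E ∈ Ū_S` for `u ∈ U_{E,S}`, `E ⊆ K_S`. [cite: NeukirchSchmidtWingberg2008, VIII §3 (8.3.9)] -/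
theorem unitsToKS_mem {E : GalLayer K}
    (hE : ramificationSubgroup K (↑S : Set (HeightOneSpectrum (𝓞 K))) ≤ galFixing K E.1)
    (u : haveI := E.numberField; (IdeleCohomology.unitsOffRep K E.1 S).V) : unitsToKS S hE u ∈ unitsOffKS K S :=
  ⟨E, hE, u, rfl⟩

/-- `[c]_E ∈ Ū_S` for `c` in the image of `U_{E,S} → C_E`. [cite: NeukirchSchmidtWingberg2008, VIII §3 (8.3.9)] -/
theorem toKS_mem_unitsOffKS_of_mem_range {E : GalLayer K}
    (hE : ramificationSubgroup K (↑S : Set (HeightOneSpectrum (𝓞 K))) ≤ galFixing K E.1) {c : layerClass K E}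
    (hc : haveI := E.numberField; c ∈ (IdeleCohomology.unitsOffToClass (F := K) (E := E.1) S).hom.range) :
    toKS S hE c ∈ unitsOffKS K S := by
  obtain ⟨u, rfl⟩ := hc
  exact unitsToKS_mem S hE u

/-- **`Ū_S` is `G_S`-stable**: `[σ] • [u]_E = [σ|_E • u]_E` (`U_{E,S} → C_E` is `Gal(E/K)`-equivariant).
[cite: Harari2020, Def. 15.38, §17.1 Thm. 17.2 (proof)] -/
theorem classBarKS_ρ_mk_unitsToKS (σ : absoluteGaloisGroup K) {E : GalLayer K}
    (hE : ramificationSubgroup K (↑S : Set (HeightOneSpectrum (𝓞 K))) ≤ galFixing K E.1)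
    (u : haveI := E.numberField; (IdeleCohomology.unitsOffRep K E.1 S).V) :
    (classBarKS K S).ρ (QuotientGroup.mk σ) (unitsToKS S hE u) =
      unitsToKS S hE (haveI := E.numberField; haveI := E.isGalois;
        (IdeleCohomology.unitsOffRep K E.1 S).ρ (σ.restrictNormal E.1) u) := by
  haveI := E.numberField
  haveI := E.isGalois
  rw [unitsToKS_apply, classBarKS_ρ_mk_toKS, unitsToKS_apply]
  exact congrArg (toKS S hE) (Rep.hom_comm_apply (IdeleCohomology.unitsOffToClass (F := K) (E := E.1) S) _ u).symm

/-- **`Ū_S` is `G_S`-stable** (submodule form, the hypothesis of Mathlib's `Representation.quotient`).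
[cite: Harari2020, Def. 15.38, §17.1 Thm. 17.2 (proof)] -/
theorem unitsOffKS_le_comap (g : GaloisGroupUnramifiedOutside K (↑S : Set (HeightOneSpectrum (𝓞 K)))) :
    unitsOffKS K S ≤ (unitsOffKS K S).comap ((classBarKS K S).ρ g) := by
  induction g using QuotientGroup.induction_on with
  | H σ =>
    rintro _ ⟨E, hE, u, rfl⟩
    rw [Submodule.mem_comap, classBarKS_ρ_mk_unitsToKS]
    exact unitsToKS_mem S hE _

/-! ## §4. `C̄_S = C_{K_S} ⧸ Ū_S` as a discrete `G_S`-module -/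

variable (K) in
/-- **The `S`-idèle class module `C̄_S = C_{K_S} ⧸ Ū_S`** as a representation of `G_S` on the quotient module (Mathlib
`Representation.quotient`; Harari's `C_S = lim→ C_S(F)`, Milne's `C_S`). [cite: Harari2020, Def. 15.38, §17.1 Thm. 17.2]
[cite: MilneADT2006, I §4 (p. 55)] -/
def classBarSRepr : Representation ℤ (GaloisGroupUnramifiedOutside K (↑S : Set (HeightOneSpectrum (𝓞 K))))
    ((classBarKS K S).V ⧸ unitsOffKS K S) :=
  (classBarKS K S).ρ.quotient (unitsOffKS K S) (unitsOffKS_le_comap S)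

variable (K) in
/-- **`C̄_S` as an object of `Rep ℤ G_S`.** [cite: Harari2020, §17.1 Thm. 17.2][cite: MilneADT2006, I §4 (p. 55)] -/
abbrev classBarSRep : Rep ℤ (GaloisGroupUnramifiedOutside K (↑S : Set (HeightOneSpectrum (𝓞 K)))) :=
  Rep.of (classBarSRepr K S)

/-- Formula for the action on `C̄_S`: `g • [z] = [g • z]`. [cite: Harari2020, §17.1 Thm. 17.2] -/
theorem classBarSRep_ρ_mk (g : GaloisGroupUnramifiedOutside K (↑S : Set (HeightOneSpectrum (𝓞 K))))
    (z : (classBarKS K S).V) :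
    (classBarSRep K S).ρ g (Submodule.Quotient.mk z) = Submodule.Quotient.mk ((classBarKS K S).ρ g z) := rfl

variable (K) in
/-- **The projection `C_{K_S} → C̄_S`** as a morphism of `Rep ℤ G_S`. [cite: Harari2020, Def. 15.38, §17.1 Thm. 17.2] -/
def toClassBarS : classBarKS K S ⟶ classBarSRep K S :=
  Rep.ofHom (LinearMap.intertwiningMap_of_isIntertwiningMap (classBarKS K S).ρ (classBarSRepr K S) (unitsOffKS K S).mkQ
    fun _ _ => rfl)

/-- `toClassBarS` is the quotient map. [cite: Harari2020, Def. 15.38] -/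
theorem toClassBarS_hom_apply (z : (classBarKS K S).V) : (toClassBarS K S).hom z = Submodule.Quotient.mk z := rfl

/-- `C_{K_S} → C̄_S` is onto. [cite: Harari2020, Def. 15.38] -/
theorem toClassBarS_surjective : Function.Surjective (toClassBarS K S).hom :=
  Submodule.mkQ_surjective _

/-- **`C_E → C̄_S`, `x ↦ [x]_E mod Ū_S`**, for a layer `E ⊆ K_S` (through it `C_S(E) = C_E ⧸ U_{E,S}` maps to `C̄_S`).
[cite: Harari2020, §17.1 Thm. 17.2 (proof)][cite: MilneADT2006, I §4 (p. 55)] -/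
def ofLayerS {E : GalLayer K} (hE : ramificationSubgroup K (↑S : Set (HeightOneSpectrum (𝓞 K))) ≤ galFixing K E.1) :
    layerClass K E →+ (classBarSRep K S).V :=
  (unitsOffKS K S).mkQ.toAddMonoidHom.comp (toKS S hE)

/-- Formula: `ofLayerS hE x = [toKS hE x]`. [cite: Harari2020, §17.1 Thm. 17.2 (proof)] -/
theorem ofLayerS_apply {E : GalLayer K}
    (hE : ramificationSubgroup K (↑S : Set (HeightOneSpectrum (𝓞 K))) ≤ galFixing K E.1) (x : layerClass K E) :
    ofLayerS S hE x = Submodule.Quotient.mk (toKS S hE x) := rfl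

/-- `C_E → C_{E'} → C̄_S` is `C_E → C̄_S` for layers `E ≤ E'` inside `K_S`. [cite: MilneADT2006, I §4 (p. 55)] -/
theorem ofLayerS_transHom {E E' : GalLayer K} (h : E ≤ E')
    (hE : ramificationSubgroup K (↑S : Set (HeightOneSpectrum (𝓞 K))) ≤ galFixing K E.1)
    (hE' : ramificationSubgroup K (↑S : Set (HeightOneSpectrum (𝓞 K))) ≤ galFixing K E'.1) (x : layerClass K E) :
    ofLayerS S hE' (transHom E E' h x) = ofLayerS S hE x := by
  rw [ofLayerS_apply, ofLayerS_apply, toKS_transHom]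

/-- **Every element of `C̄_S` comes from a layer inside `K_S`** (`C̄_S = lim→_{F ⊆ K_S} C_S(F)`).
[cite: MilneADT2006, I §4 (p. 55)][cite: Harari2020, §17.1 Thm. 17.2 (proof)] -/
theorem exists_ofLayerS (z : (classBarSRep K S).V) :
    ∃ (E : GalLayer K) (hE : ramificationSubgroup K (↑S : Set (HeightOneSpectrum (𝓞 K))) ≤ galFixing K E.1)
      (x : layerClass K E), ofLayerS S hE x = z := by
  obtain ⟨y, rfl⟩ := Submodule.mkQ_surjective (unitsOffKS K S) z
  obtain ⟨E, hE, x, rfl⟩ := exists_toKS S y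
  exact ⟨E, hE, x, rfl⟩

/-- `ofLayerS hE x = 0 ↔ [x]_E ∈ Ū_S`. [cite: Harari2020, Def. 15.38] -/
theorem ofLayerS_eq_zero_iff_mem {E : GalLayer K}
    (hE : ramificationSubgroup K (↑S : Set (HeightOneSpectrum (𝓞 K))) ≤ galFixing K E.1) (x : layerClass K E) :
    ofLayerS S hE x = 0 ↔ toKS S hE x ∈ unitsOffKS K S := by
  rw [ofLayerS_apply]
  exact Submodule.Quotient.mk_eq_zero _

/-- **`U_{E,S}` dies in `C̄_S`**: `ofLayerS hE [u] = 0` for `u ∈ U_{E,S}`. [cite: Harari2020, Def. 15.38] -/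
theorem ofLayerS_unitsOffToClass {E : GalLayer K}
    (hE : ramificationSubgroup K (↑S : Set (HeightOneSpectrum (𝓞 K))) ≤ galFixing K E.1)
    (u : haveI := E.numberField; (IdeleCohomology.unitsOffRep K E.1 S).V) :
    ofLayerS S hE (haveI := E.numberField; (IdeleCohomology.unitsOffToClass (F := K) (E := E.1) S).hom u) = 0 :=
  (ofLayerS_eq_zero_iff_mem S hE _).2 (unitsToKS_mem S hE u)

/-- `ofLayerS hE` kills the image of `U_{E,S} → C_E`. [cite: Harari2020, Def. 15.38] -/
theorem ofLayerS_eq_zero_of_mem_range {E : GalLayer K}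
    (hE : ramificationSubgroup K (↑S : Set (HeightOneSpectrum (𝓞 K))) ≤ galFixing K E.1) {c : layerClass K E}
    (hc : haveI := E.numberField; c ∈ (IdeleCohomology.unitsOffToClass (F := K) (E := E.1) S).hom.range) :
    ofLayerS S hE c = 0 :=
  (ofLayerS_eq_zero_iff_mem S hE c).2 (toKS_mem_unitsOffKS_of_mem_range S hE hc)

/-- **`[σ] • ofLayerS [x]_E = ofLayerS [σ|_E • x]_E`** (`G_S` acts on the layer through `Gal(E/K)`).
[cite: Harari2020, §17.1 Thm. 17.2 (proof)] -/
theorem classBarSRep_ρ_mk_ofLayerS (σ : absoluteGaloisGroup K) {E : GalLayer K}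
    (hE : ramificationSubgroup K (↑S : Set (HeightOneSpectrum (𝓞 K))) ≤ galFixing K E.1) (x : layerClass K E) :
    (classBarSRep K S).ρ (QuotientGroup.mk σ) (ofLayerS S hE x) = ofLayerS S hE (layerAct K E σ x) := by
  rw [ofLayerS_apply, ofLayerS_apply, classBarSRep_ρ_mk, classBarKS_ρ_mk_toKS]

/-- **`Gal(K_S/E)` fixes the image of `C_E` in `C̄_S`**: `[σ] • ofLayerS x = ofLayerS x` for `σ ∈ Gal(K̄/E)`
(so `im(C_E → C̄_S) ⊆ C̄_S^{Gal(K_S/E)}`; equality is the sequel). [cite: NeukirchSchmidtWingberg2008, VIII §3 (8.3.7)]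
[cite: Harari2020, §17.1 Thm. 17.2 (proof)] -/
theorem classBarSRep_ρ_mk_ofLayerS_of_mem {E : GalLayer K}
    (hE : ramificationSubgroup K (↑S : Set (HeightOneSpectrum (𝓞 K))) ≤ galFixing K E.1)
    {σ : absoluteGaloisGroup K} (hσ : σ ∈ galFixing K E.1) (x : layerClass K E) :
    (classBarSRep K S).ρ (QuotientGroup.mk σ) (ofLayerS S hE x) = ofLayerS S hE x := by
  rw [ofLayerS_apply, classBarSRep_ρ_mk, classBarKS_ρ_mk_toKS_of_mem S hE hσ]

/-- The stabiliser of `ofLayerS [x]_E ∈ C̄_S` contains the open subgroup `Gal(K_S/E)`. [cite: Harari2020, §4.2 and §17.1] -/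
theorem map_galFixing_le_stabilizer_ofLayerS {E : GalLayer K}
    (hE : ramificationSubgroup K (↑S : Set (HeightOneSpectrum (𝓞 K))) ≤ galFixing K E.1) (x : layerClass K E) :
    (galFixing K E.1).map (QuotientGroup.mk' (ramificationSubgroup K (↑S : Set (HeightOneSpectrum (𝓞 K))))) ≤
      DiscreteRep.stabilizer (classBarSRep K S) (ofLayerS S hE x) := by
  rintro _ ⟨σ, hσ, rfl⟩
  exact classBarSRep_ρ_mk_ofLayerS_of_mem S hE hσ x

/-- **`C̄_S` is a discrete `G_S`-module** (a quotient of the discrete `C_{K_S}`). [cite: Harari2020, §4.2 and §17.1]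
[cite: MilneADT2006, I §4] -/
theorem isDiscrete_classBarSRep : DiscreteRep.IsDiscrete (classBarSRep K S) :=
  (isDiscrete_classBarKS S).of_surjective (toClassBarS K S) (toClassBarS_surjective S)

variable (K) in
/-- **`C̄_S` as an object of `C_{G_S} = DiscreteRepCat ℤ G_S`** — the module of the `P`-class formation `(G_S, C̄_S)` on which
door-c4's Tate duality engine is to be run. [cite: Harari2020, §17.1 Thm. 17.2][cite: MilneADT2006, I §4] -/
abbrev classBarSD : DiscreteRepCat ℤ (GaloisGroupUnramifiedOutside K (↑S : Set (HeightOneSpectrum (𝓞 K)))) :=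
  DiscreteRep.mk (classBarSRep K S) (isDiscrete_classBarSRep S)

variable (K) in
/-- The projection `C_{K_S} → C̄_S` in `C_{G_S}`. [cite: Harari2020, Def. 15.38, §17.1 Thm. 17.2] -/
def toClassBarSD : classBarKSD K S ⟶ classBarSD K S :=
  ObjectProperty.homMk (toClassBarS K S)

/-- `toClassBarSD` is `toClassBarS` on underlying representations. [cite: Harari2020, Def. 15.38] -/
theorem toClassBarSD_hom : (toClassBarSD K S).hom = toClassBarS K S := rfl

end IdeleClassBar

end Literature.NumberTheory.GaloisRepresentations

end
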